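import Literature.Geometry.ComplexAnalytic.HolomorphicSplittingCriticalCurve
import Mathlib.Analysis.Analytic.Order
import Mathlib.Analysis.Complex.CauchyIntegral
import Mathlib.Analysis.SpecialFunctions.Pow.Deriv
import HarnessLib

/-!
# The `A_{p-1}` normal-form chart along a critical curve: `φ = φ 0 + Σ wᵢ² + u^p`

Layer `Literature/Geometry/ComplexAnalytic`; theorems only. Written by the prover seat `hodge-nonav-prover-Bx` (g16, cell
`hodge-nonav`) as brick B4a-3 of the programme «A₃-TRACE» (crux K1-B of `Summits/HodgeConjecture/HodgeConjecture/Theses/SignSymmetricPowers.lean`,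
stmt-HodgeConjecture-19716), sequel of `HolomorphicSplittingCriticalCurve`.

* `exists_eq_pow_of_analyticOrderAt` — a holomorphic `ρ` with a zero of order exactly `k ≥ 1` at `0` is the `k`-th power of
  a local coordinate: `ρ = v^k` near `0` with `v` holomorphic, `v 0 = 0`, `v' 0 ≠ 0` (Rudin, *Real and Complex Analysis*,
  Thm. 10.32; Forster, *Riemann surfaces*, Thm. 2.1).
* `exists_powChart_of_criticalCurve` — in the situation of the splitting lemma along a critical curve
  (`exists_splittingChart_of_criticalCurve`: `φ` holomorphic near `0 ∈ ℂ^{m+2}`, `dφ(0) = 0`, `w`-Hessian non-degenerate,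
  holomorphic critical curve `u ↦ (c u, u)`), if moreover the restriction `u ↦ φ (c u, u) - φ 0` has a zero of order
  exactly `p` at `0`, then there is a holomorphic chart `Θ` at `0` (`Θ 0 = 0`, real `C^∞` with `C^∞` inverse) with
  `φ z = φ 0 + Σ_{i ≤ m} (Θ z)ᵢ.castSucc² + ((Θ z) last)^p`, i.e. `Σᵢ (Θ z i)^{aᵢ} = φ z - φ 0` for the weight vector
  `a = (2, …, 2, p)` (`exists_powChart_of_criticalCurve'`): the normal form `A_{p-1}` of AGZV I §11.1 (for `p = 4`: the
  `A₃` point `x⁴ + Σ yᵢ²`), obtained WITHOUT the classification theorem from the splitting lemma and the order of the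
  restriction to the critical curve.

## References

* [ArnoldGuseinZadeVarchenko1985] V. I. Arnold, S. M. Gusein-Zade, A. N. Varchenko, *Singularities of Differentiable Maps* I,
  §9.6 (Morse lemma with parameters), §11.1 (the series `A_k : x^{k+1} + Σ yᵢ²`).
* [Rudin1987] W. Rudin, *Real and Complex Analysis*, 3rd ed., Thm. 10.32.
* [Forster1981] O. Forster, *Lectures on Riemann Surfaces*, Thm. 2.1 (local normal form of holomorphic maps).
-/

noncomputable section

open Set Function Filter Module Metric Complex
open scoped Topology ContDiff

set_option maxSynthPendingDepth 2

namespace Literature.Geometry.ComplexAnalytic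

namespace HolomorphicSplitting

variable {m : ℕ}

/-- `Fin.snoc 0 0 = 0`. [folklore] -/
private theorem snoc_zero_zero' : (Fin.snoc (0 : Fin (m + 1) → ℂ) (0 : ℂ) : Fin (m + 2) → ℂ) = 0 := by
  funext k
  refine Fin.lastCases ?_ (fun j => ?_) k
  · simp [Fin.snoc_last]
  · simp [Fin.snoc_castSucc]

/-- **Local normal form of a holomorphic function at a zero of order `k`** (Rudin RCA Thm. 10.32, Forster Thm. 2.1):
if `ρ` is analytic at `0` with `analyticOrderAt ρ 0 = k`, `k ≠ 0`, then `ρ = v ^ k` on a disc around `0` for a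
holomorphic `v` with `v 0 = 0` and `v' 0 ≠ 0` (a local coordinate).  Proof: `ρ u = u^k g u` with `g 0 ≠ 0`; take
`v u = u · κ · (g u / g 0)^{1/k}` with `κ^k = g 0` and the principal branch on the slit plane.
[cite: Rudin1987, Thm. 10.32] [cite: Forster1981, Thm. 2.1] -/
theorem exists_eq_pow_of_analyticOrderAt {ρ : ℂ → ℂ} {k : ℕ} (hk : k ≠ 0) (hρ : AnalyticAt ℂ ρ 0)
    (hord : analyticOrderAt ρ 0 = k) :
    ∃ r : ℝ, 0 < r ∧ ∃ v : ℂ → ℂ, DifferentiableOn ℂ v (ball 0 r) ∧ v 0 = 0 ∧ deriv v 0 ≠ 0 ∧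
      ∀ u ∈ ball (0 : ℂ) r, ρ u = (v u) ^ k := by
  obtain ⟨g, hg, hg0, hev⟩ := hρ.analyticOrderAt_eq_natCast.1 hord
  obtain ⟨κ, hκ⟩ := IsAlgClosed.exists_pow_nat_eq (g 0) (Nat.pos_of_ne_zero hk)
  have hκ0 : κ ≠ 0 := by
    rintro rfl
    rw [zero_pow hk] at hκ
    exact hg0 hκ.symm
  -- near `0`: `g` is differentiable, `g u / g 0` lies in the slit plane, and `ρ u = u ^ k • g u`
  have h1 : ∀ᶠ u in 𝓝 (0 : ℂ), DifferentiableAt ℂ g u :=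
    hg.eventually_analyticAt.mono fun u hu => hu.differentiableAt
  have h2 : ∀ᶠ u in 𝓝 (0 : ℂ), g u / g 0 ∈ slitPlane := by
    have hc : ContinuousAt (fun u => g u / g 0 - 1) 0 := (hg.continuousAt.div_const _).sub continuousAt_const
    have hmem : ball (0 : ℂ) 1 ∈ 𝓝 ((fun u => g u / g 0 - 1) 0) := by
      refine isOpen_ball.mem_nhds ?_
      show g 0 / g 0 - 1 ∈ ball (0 : ℂ) 1
      rw [div_self hg0, sub_self]
      exact mem_ball_self one_pos
    filter_upwards [hc.eventually_mem hmem] with u hu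
    have h := mem_slitPlane_of_norm_lt_one (mem_ball_zero_iff.1 hu)
    rwa [add_sub_cancel] at h
  obtain ⟨r, hr, hball⟩ := Metric.eventually_nhds_iff_ball.1 (hev.and (h1.and h2))
  refine ⟨r, hr, fun u => u * (κ * (g u / g 0) ^ ((k : ℂ)⁻¹)), ?_, by simp, ?_, ?_⟩
  · intro u hu
    obtain ⟨-, hgu, hsu⟩ := hball u hu
    exact (differentiableAt_id.mul (((hgu.div_const _).cpow_const hsu).const_mul κ)).differentiableWithinAt
  · have hw : DifferentiableAt ℂ (fun u => κ * (g u / g 0) ^ ((k : ℂ)⁻¹)) 0 := by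
      obtain ⟨-, hgu, hsu⟩ := hball 0 (mem_ball_self hr)
      exact ((hgu.div_const _).cpow_const hsu).const_mul κ
    have hd : HasDerivAt (fun u => u * (κ * (g u / g 0) ^ ((k : ℂ)⁻¹)))
        (1 * (κ * (g 0 / g 0) ^ ((k : ℂ)⁻¹)) + 0 * deriv (fun u => κ * (g u / g 0) ^ ((k : ℂ)⁻¹)) 0) 0 :=
      (hasDerivAt_id' (0 : ℂ)).mul hw.hasDerivAt
    rw [hd.deriv, div_self hg0, one_cpow, mul_one, one_mul, zero_mul, add_zero]
    exact hκ0
  · intro u hu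
    obtain ⟨hρu, -, -⟩ := hball u hu
    rw [hρu, sub_zero, smul_eq_mul, mul_pow, mul_pow, hκ, cpow_nat_inv_pow _ hk, ← mul_div_assoc,
      mul_div_cancel_left₀ _ hg0]

/-- **The `A_{p-1}` chart along a critical curve** (module docstring): under the hypotheses of
`exists_splittingChart_of_criticalCurve` and `analyticOrderAt (u ↦ φ (c u, u) - φ 0) 0 = p ≠ 0`, there is a holomorphic
chart `Θ` at `0` (`0 ∈ Θ.source ⊆ U`, `Θ 0 = 0`, real `C^∞` with `C^∞` inverse) with
`φ z = φ 0 + Σ_{i ≤ m} (Θ z)ᵢ.castSucc² + ((Θ z) last)^p` on `Θ.source`.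
[cite: ArnoldGuseinZadeVarchenko1985, §9.6 and §11.1] [cite: Rudin1987, Thm. 10.32] -/
theorem exists_powChart_of_criticalCurve {U : Set (Fin (m + 2) → ℂ)} (hU : IsOpen U)
    {φ : (Fin (m + 2) → ℂ) → ℂ} (hφ : DifferentiableOn ℂ φ U) (h0 : (0 : Fin (m + 2) → ℂ) ∈ U)
    {r₁ : ℝ} (hr₁ : 0 < r₁) {c : ℂ → (Fin (m + 1) → ℂ)} (hc : DifferentiableOn ℂ c (ball 0 r₁)) (hc0 : c 0 = 0)
    (hcU : ∀ u ∈ ball (0 : ℂ) r₁, (Fin.snoc (c u) u : Fin (m + 2) → ℂ) ∈ U)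
    (hcrit : ∀ u ∈ ball (0 : ℂ) r₁, ∀ i : Fin (m + 1),
      fderiv ℂ φ (Fin.snoc (c u) u) (Pi.single i.castSucc 1) = 0)
    (h1 : fderiv ℂ φ 0 = 0) {L : (Fin (m + 2) → ℂ) →L[ℂ] (Fin (m + 2) → ℂ) →L[ℂ] ℂ}
    (h2 : HasFDerivAt (fderiv ℂ φ) L 0)
    (hL : ∀ u : Fin (m + 1) → ℂ, (∀ v : Fin (m + 1) → ℂ, L (Fin.snoc u 0) (Fin.snoc v 0) = 0) → u = 0)
    {p : ℕ} (hp : p ≠ 0) (hord : analyticOrderAt (fun u : ℂ => φ (Fin.snoc (c u) u) - φ 0) 0 = p) :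
    ∃ Θ : OpenPartialHomeomorph (Fin (m + 2) → ℂ) (Fin (m + 2) → ℂ),
      (0 : Fin (m + 2) → ℂ) ∈ Θ.source ∧ Θ 0 = 0 ∧ Θ.source ⊆ U ∧
      DifferentiableOn ℂ Θ Θ.source ∧ ContDiffOn ℝ ∞ Θ Θ.source ∧ ContDiffOn ℝ ∞ Θ.symm Θ.target ∧
      ∀ z ∈ Θ.source, φ z = φ 0 + ∑ i : Fin (m + 1), (Θ z i.castSucc) ^ 2 + (Θ z (Fin.last (m + 1))) ^ p := by
  classical
  obtain ⟨Θ₁, h0Θ₁, hΘ₁0, hΘ₁U, -, hΘ₁d, hΘ₁cd, hΘ₁scd, hΘ₁last, hΘ₁φ⟩ :=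
    exists_splittingChart_of_criticalCurve hU hφ h0 hr₁ hc hc0 hcU hcrit h1 h2 hL
  -- the restriction to the critical curve is the `p`-th power of a local coordinate `v`
  have hγd : DifferentiableOn ℂ (fun u : ℂ => (Fin.snoc (c u) u : Fin (m + 2) → ℂ)) (ball 0 r₁) :=
    differentiableOn_pi.2 fun k => Fin.lastCases
      (by simp only [Fin.snoc_last]; exact differentiableOn_id)
      (fun j => by simp only [Fin.snoc_castSucc]; exact (differentiableOn_pi.1 hc) j) k
  have hρd : DifferentiableOn ℂ (fun u : ℂ => φ (Fin.snoc (c u) u) - φ 0) (ball 0 r₁) :=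
    (hφ.comp hγd fun u hu => hcU u hu).sub_const _
  have hρA : AnalyticAt ℂ (fun u : ℂ => φ (Fin.snoc (c u) u) - φ 0) 0 :=
    hρd.analyticAt (isOpen_ball.mem_nhds (mem_ball_self hr₁))
  obtain ⟨r₂, hr₂, v, hvd, hv0, hv'0, hρv⟩ := exists_eq_pow_of_analyticOrderAt hp hρA hord
  have hvd0 : HasDerivAt v (deriv v 0) 0 := (hvd.differentiableAt (isOpen_ball.mem_nhds (mem_ball_self hr₂))).hasDerivAt
  -- the coordinate change `V z = (init z, v (z last))` on the strip `‖z last‖ < r₂`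
  have hS₂o : IsOpen {z : Fin (m + 2) → ℂ | ‖z (Fin.last (m + 1))‖ < r₂} :=
    isOpen_lt (continuous_norm.comp (continuous_apply _)) continuous_const
  have h0S₂ : (0 : Fin (m + 2) → ℂ) ∈ {z : Fin (m + 2) → ℂ | ‖z (Fin.last (m + 1))‖ < r₂} := by
    simpa using hr₂
  set V : (Fin (m + 2) → ℂ) → (Fin (m + 2) → ℂ) := fun z => Fin.snoc (Fin.init z) (v (z (Fin.last (m + 1)))) with hV
  have hVcs : ∀ z (i : Fin (m + 1)), V z i.castSucc = z i.castSucc := fun z i => by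
    simp only [hV, Fin.snoc_castSucc, Fin.init]
  have hVlast : ∀ z, V z (Fin.last (m + 1)) = v (z (Fin.last (m + 1))) := fun z => by
    simp only [hV, Fin.snoc_last]
  have hVd : DifferentiableOn ℂ V {z | ‖z (Fin.last (m + 1))‖ < r₂} := by
    refine differentiableOn_pi.2 fun k => Fin.lastCases ?_ (fun j => ?_) k
    · simp only [hVlast]
      exact hvd.comp (differentiable_apply _).differentiableOn fun z hz => mem_ball_zero_iff.2 hz
    · simp only [hVcs]
      exact (differentiable_apply _).differentiableOn
  have hVcd : ContDiffOn ℂ ∞ V {z | ‖z (Fin.last (m + 1))‖ < r₂} :=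
    (Literature.Analysis.Complex.SCV.analyticOnNhd_of_differentiableOn hVd hS₂o).contDiffOn_of_completeSpace
  -- its derivative at `0`: `T z = (init z, v' 0 · z last)`, an automorphism
  let Tℓ : (Fin (m + 2) → ℂ) ≃ₗ[ℂ] (Fin (m + 2) → ℂ) :=
    { toFun := fun z => Fin.snoc (Fin.init z) (deriv v 0 * z (Fin.last (m + 1)))
      invFun := fun z => Fin.snoc (Fin.init z) ((deriv v 0)⁻¹ * z (Fin.last (m + 1)))
      map_add' := fun z z' => by
        funext k
        refine Fin.lastCases ?_ (fun j => ?_) k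
        · simp only [Fin.snoc_last, Pi.add_apply]; ring
        · simp only [Fin.snoc_castSucc, Fin.init, Pi.add_apply]
      map_smul' := fun c z => by
        funext k
        refine Fin.lastCases ?_ (fun j => ?_) k
        · simp only [Fin.snoc_last, Pi.smul_apply, smul_eq_mul, RingHom.id_apply]; ring
        · simp only [Fin.snoc_castSucc, Fin.init, Pi.smul_apply, RingHom.id_apply]
      left_inv := fun z => by
        simp only [Fin.init_snoc, Fin.snoc_last, inv_mul_cancel_left₀ hv'0]
        exact Fin.snoc_init_self z
      right_inv := fun z => by
        simp only [Fin.init_snoc, Fin.snoc_last, mul_inv_cancel_left₀ hv'0]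
        exact Fin.snoc_init_self z }
  let T : (Fin (m + 2) → ℂ) ≃L[ℂ] (Fin (m + 2) → ℂ) := Tℓ.toContinuousLinearEquiv
  have hT : ∀ z, T z = Fin.snoc (Fin.init z) (deriv v 0 * z (Fin.last (m + 1))) := fun z => rfl
  have hVderiv : HasFDerivAt V (T : (Fin (m + 2) → ℂ) →L[ℂ] (Fin (m + 2) → ℂ)) 0 := by
    refine hasFDerivAt_pi'' fun k => Fin.lastCases ?_ (fun j => ?_) k
    · have hv' : HasFDerivAt (fun z : Fin (m + 2) → ℂ => v (z (Fin.last (m + 1))))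
          ((ContinuousLinearMap.smulRight (1 : ℂ →L[ℂ] ℂ) (deriv v 0)).comp
            (ContinuousLinearMap.proj (R := ℂ) (φ := fun _ : Fin (m + 2) => ℂ) (Fin.last (m + 1)))) 0 := by
        have h : HasDerivAt v (deriv v 0) ((0 : Fin (m + 2) → ℂ) (Fin.last (m + 1))) := by
          rw [Pi.zero_apply]; exact hvd0
        exact h.hasFDerivAt.comp (0 : Fin (m + 2) → ℂ) (hasFDerivAt_apply (Fin.last (m + 1)) _)
      simp only [hVlast]
      refine hv'.congr_fderiv ?_
      ext w
      simp only [ContinuousLinearMap.comp_apply, ContinuousLinearMap.proj_apply, ContinuousLinearMap.smulRight_apply,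
        one_apply_eq_self, smul_eq_mul, ContinuousLinearEquiv.coe_coe, hT, Fin.snoc_last]
      ring
    · simp only [hVcs]
      refine (hasFDerivAt_apply j.castSucc (0 : Fin (m + 2) → ℂ)).congr_fderiv ?_
      ext w
      simp only [ContinuousLinearMap.comp_apply, ContinuousLinearMap.proj_apply, ContinuousLinearEquiv.coe_coe, hT,
        Fin.snoc_castSucc, Fin.init]
  obtain ⟨G, hGV, h0G, hGS₂, hGcd, hGscd, -⟩ :=
    HolomorphicMorse.exists_openPartialHomeomorph_contDiffOn_symm hS₂o h0S₂ (m := ∞) (by simp) hVcd T hVderiv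
  -- the chart `Θ = G ∘ Θ₁`
  refine ⟨Θ₁.trans G, ?_, ?_, ?_, ?_, ?_, ?_, ?_⟩
  · rw [OpenPartialHomeomorph.trans_source]
    exact ⟨h0Θ₁, by rw [mem_preimage, hΘ₁0]; exact h0G⟩
  · rw [OpenPartialHomeomorph.coe_trans, comp_apply, hΘ₁0, hGV]
    show Fin.snoc (Fin.init (0 : Fin (m + 2) → ℂ)) (v ((0 : Fin (m + 2) → ℂ) (Fin.last (m + 1)))) = 0
    rw [Pi.zero_apply, hv0]
    exact snoc_zero_zero'
  · rw [OpenPartialHomeomorph.trans_source]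
    exact fun z hz => hΘ₁U hz.1
  · rw [OpenPartialHomeomorph.coe_trans, OpenPartialHomeomorph.trans_source]
    exact ((hGcd.differentiableOn (by simp)).congr fun z _ => by rw [hGV]).comp
      (hΘ₁d.mono inter_subset_left) fun z hz => by simpa [hGV] using hz.2
  · rw [OpenPartialHomeomorph.coe_trans, OpenPartialHomeomorph.trans_source]
    exact (hGcd.restrict_scalars ℝ).comp (hΘ₁cd.mono inter_subset_left) fun z hz => hz.2
  · rw [OpenPartialHomeomorph.coe_trans_symm, OpenPartialHomeomorph.trans_target]
    exact hΘ₁scd.comp ((hGscd.restrict_scalars ℝ).mono inter_subset_left) fun z hz => hz.2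
  · intro z hz
    rw [OpenPartialHomeomorph.trans_source] at hz
    have hz₂ : ‖z (Fin.last (m + 1))‖ < r₂ := by
      have h : Θ₁ z ∈ {z : Fin (m + 2) → ℂ | ‖z (Fin.last (m + 1))‖ < r₂} := hGS₂ hz.2
      rw [mem_setOf_eq, hΘ₁last z hz.1] at h
      exact h
    have hΘz : (Θ₁.trans G) z = V (Θ₁ z) := by
      rw [OpenPartialHomeomorph.coe_trans, comp_apply, hGV]
    have hρ := hρv _ (mem_ball_zero_iff.2 hz₂)
    rw [sub_eq_iff_eq_add'] at hρ
    rw [hΘz, hVlast, hΘ₁last z hz.1, hΘ₁φ z hz.1, hρ]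
    simp only [hVcs]
    ring

/-- **The `A_{p-1}` chart, weight-vector form**: same hypotheses; the chart satisfies
`Σᵢ (Θ z i)^{aᵢ} = φ z - φ 0` with `a = Fin.snoc (fun _ ↦ 2) p` (weights `(2, …, 2, p)`), the shape consumed by the
weighted-pencil shell submersion `PhamBrieskorn.surjective_fderiv_pencil_suspendedRadius_of_shell` and the
Pham–Brieskorn local models. [cite: ArnoldGuseinZadeVarchenko1985, §9.6 and §11.1] [cite: Rudin1987, Thm. 10.32] -/
theorem exists_powChart_of_criticalCurve' {U : Set (Fin (m + 2) → ℂ)} (hU : IsOpen U)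
    {φ : (Fin (m + 2) → ℂ) → ℂ} (hφ : DifferentiableOn ℂ φ U) (h0 : (0 : Fin (m + 2) → ℂ) ∈ U)
    {r₁ : ℝ} (hr₁ : 0 < r₁) {c : ℂ → (Fin (m + 1) → ℂ)} (hc : DifferentiableOn ℂ c (ball 0 r₁)) (hc0 : c 0 = 0)
    (hcU : ∀ u ∈ ball (0 : ℂ) r₁, (Fin.snoc (c u) u : Fin (m + 2) → ℂ) ∈ U)
    (hcrit : ∀ u ∈ ball (0 : ℂ) r₁, ∀ i : Fin (m + 1),
      fderiv ℂ φ (Fin.snoc (c u) u) (Pi.single i.castSucc 1) = 0)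
    (h1 : fderiv ℂ φ 0 = 0) {L : (Fin (m + 2) → ℂ) →L[ℂ] (Fin (m + 2) → ℂ) →L[ℂ] ℂ}
    (h2 : HasFDerivAt (fderiv ℂ φ) L 0)
    (hL : ∀ u : Fin (m + 1) → ℂ, (∀ v : Fin (m + 1) → ℂ, L (Fin.snoc u 0) (Fin.snoc v 0) = 0) → u = 0)
    {p : ℕ} (hp : p ≠ 0) (hord : analyticOrderAt (fun u : ℂ => φ (Fin.snoc (c u) u) - φ 0) 0 = p) :
    ∃ Θ : OpenPartialHomeomorph (Fin (m + 2) → ℂ) (Fin (m + 2) → ℂ),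
      (0 : Fin (m + 2) → ℂ) ∈ Θ.source ∧ Θ 0 = 0 ∧ Θ.source ⊆ U ∧
      DifferentiableOn ℂ Θ Θ.source ∧ ContDiffOn ℝ ∞ Θ Θ.source ∧ ContDiffOn ℝ ∞ Θ.symm Θ.target ∧
      ∀ z ∈ Θ.source, ∑ i, (Θ z i) ^ (Fin.snoc (fun _ : Fin (m + 1) => 2) p : Fin (m + 2) → ℕ) i = φ z - φ 0 := by
  obtain ⟨Θ, h0Θ, hΘ0, hΘU, hΘd, hΘcd, hΘscd, hΘφ⟩ :=
    exists_powChart_of_criticalCurve hU hφ h0 hr₁ hc hc0 hcU hcrit h1 h2 hL hp hord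
  refine ⟨Θ, h0Θ, hΘ0, hΘU, hΘd, hΘcd, hΘscd, fun z hz => ?_⟩
  rw [Fin.sum_univ_castSucc, hΘφ z hz]
  simp only [Fin.snoc_castSucc, Fin.snoc_last]
  ring

end HolomorphicSplitting

end Literature.Geometry.ComplexAnalytic

end
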